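import Mathlib
import HarnessLib
import Summits.ABC.ABC.Theses.DefiniteXi
import Literature.NumberTheory.EllipticCurves.Szpiro
import Literature.NumberTheory.Automorphic.BrandtXi
import Literature.NumberTheory.EllipticCurves.TakahashiDegreeFormula

/-!
# Crux idea `prime-to-six-degree-avatar` — first lemma (crux `SteinbergCore`, stmt-ABC-15024)

`SteinbergCore` (B):  cps(ξ(E;N/Nm,Nm)) · ∏_{q ∣ N} v_q(Δ_min) ≤ C_ε N^(2+ε)  for every admissible `Nm`,
where `cps n = n / (2^{v₂ n} 3^{v₃ n})` is the prime-to-6 part.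

The lever: at primes `ℓ ≥ 5` NOTHING is quarantined once the full product `∏_{q ∣ N}` is folded in —
`ord_ℓ ξ(E;N⁺,N⁻) ≤ ord_ℓ η_f(N) = ord_ℓ deg φ₀ = ord_ℓ deg_min(E_(a,b))` (congruence numbers grow
along `𝕋(N) ↠ 𝕋^{N⁻-new}`; Agashe–Ribet–Stein at `ℓ² ∤ N`; Mazur–Kenku: isogenies inside a Frey class
are 6-smooth), so B follows from two `X₀(N)`-side statements with NO Brandt module:

* `PrimeToSixDegreeBound` (P6): the prime-to-6 part of the MINIMAL modular degree of `E_(a,b)` is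
  `≤ C_ε N^(2+ε)` — Frey's degree conjecture away from 6 (abc-strength; the crux's own content);
* `TBoundAll` (T): `∏_{q ∣ N} v_q(Δ_min(E_(a,b))) ≤ C_ε N^ε` — RibetTakahashiSplit's T-half
  (⟸ Szpiro on Frey curves; unconditionally `≤ N^(8/3+ε)`, `pasten2024_thm_2_5`);
* `CompWeak`: the comparison `cps ξ ≤ cps deg_min` (known in print: JL + PW 2011 Prop 6.4/Thm 6.8,
  BKM 2021 Thm 1.1, ARS 2012 Thm 2.1, Mazur–Kenku).

`steinbergCore_of : CompWeak → PrimeToSixDegreeBound → TBoundAll → SteinbergCore` is proved below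
(pure algebra; concludes the route decl BY NAME).
-/

namespace Summit.ABC.ABC.Cruxes.SteinbergCore.PrimeToSixAvatar

open Literature.NumberTheory.EllipticCurves Literature.NumberTheory.Automorphic
open Literature.NumberTheory.EllipticCurves.ModularForms

noncomputable section

/-- **Comparison away from 6, weak direction** (known in print, XL formal): whenever the definite
congruence number `ξ(E_(a,b); N/Nm, Nm)` is non-zero (so the Frey eigen-line exists in the Brandt
module, hence `E_(a,b)` is modular of level `N` by Jacquet–Langlands), `E_(a,b)` carries a
minimal-degree parametrisation datum `D` at level `N` and the prime-to-6 part of `ξ` is at most the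
prime-to-6 part of `D.deg`:  `ord_ℓ ξ ≤ ord_ℓ η^{Nm-new}_f ≤ ord_ℓ η_f(N) = ord_ℓ deg φ₀ = ord_ℓ deg D`
for every prime `ℓ ≥ 5` (PW 2011 Prop. 6.4(2)/BKM 2021 Thm 1.1: `⟨φ,φ⟩` generates the module = ring
congruence ideal; monotonicity of congruence ideals under `𝕋(N) ↠ 𝕋^{Nm-new}(N)`; ARS 2012 Thm 2.1(b)
at `ℓ² ∤ N`; Mazur–Kenku: `deg D = deg φ₀ · (6-smooth isogeny degree)`). -/
def CompWeak : Prop :=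
  ∀ a b : ℤ, IsCoprime a b → a * b * (a + b) ≠ 0 → ∀ (N : ℕ) [NeZero N],
    (freyCurve a b).conductorNorm ℤ = N →
    ∀ Nm : ℕ, Odd Nm → Squarefree Nm → Odd Nm.primeFactors.card → Nm ∣ N →
      brandtXi (N / Nm) Nm (fun n => (freyCurve a b).LFunction n) ≠ 0 →
      ∃ D : ModularParametrizationData (freyCurve a b) N,
        (∀ D' : ModularParametrizationData (freyCurve a b) N, D.deg ≤ D'.deg) ∧
        brandtXi (N / Nm) Nm (fun n => (freyCurve a b).LFunction n) /
            (ordProj[2] (brandtXi (N / Nm) Nm (fun n => (freyCurve a b).LFunction n)) *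
              ordProj[3] (brandtXi (N / Nm) Nm (fun n => (freyCurve a b).LFunction n)))
          ≤ D.deg / (ordProj[2] D.deg * ordProj[3] D.deg)

/-- **P6 — Frey's degree conjecture away from 6** (abc-strength; the crux's own content): the
prime-to-6 part of the minimal modular degree of `E_(a,b)` over `X₀(N)` is `≤ C_ε N^(2+ε)`.
Archimedean reading (Zagier, proved in tree, + `(f,f) ≍ N^(1±ε)`): `(2h_F(E) − (1+ε) log N)⁺ ≤
log(2^{v₂ deg_min} 3^{v₃ deg_min}) + O_ε(1)` — "the Szpiro excess of a Frey curve is 6-smooth". -/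
def PrimeToSixDegreeBound : Prop :=
  ∀ ε : ℝ, 0 < ε → ∃ C : ℝ, ∀ a b : ℤ, IsCoprime a b → a * b * (a + b) ≠ 0 → ∀ (N : ℕ) [NeZero N],
    (freyCurve a b).conductorNorm ℤ = N →
    ∀ D : ModularParametrizationData (freyCurve a b) N,
      (∀ D' : ModularParametrizationData (freyCurve a b) N, D.deg ≤ D'.deg) →
      ((D.deg / (ordProj[2] D.deg * ordProj[3] D.deg) : ℕ) : ℝ) ≤ C * (N : ℝ) ^ (2 + ε)

/-- **T — the full Tamagawa-exponent product is sub-polynomial** (RibetTakahashiSplit's T-half with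
the prime `2` included; ⟸ Szpiro on Frey curves; unconditionally `≤ N^(8/3+ε)` by Pasten). -/
def TBoundAll : Prop :=
  ∀ ε : ℝ, 0 < ε → ∃ C : ℝ, ∀ a b : ℤ, IsCoprime a b → a * b * (a + b) ≠ 0 → ∀ (N : ℕ) [NeZero N],
    (freyCurve a b).conductorNorm ℤ = N →
      ((∏ q ∈ N.primeFactors, ((freyCurve a b).minimalDiscriminantNorm ℤ).factorization q : ℕ) : ℝ)
        ≤ C * (N : ℝ) ^ ε

/-- **The glue**: comparison-away-from-6 + P6 + T ⟹ `SteinbergCore`, for EVERY admissible `Nm`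
(the left side of B is bounded by `cps(deg_min) · ∏_{q∣N} v_q(Δ_min)` uniformly in `Nm`). -/
theorem steinbergCore_of (hC : CompWeak) (hP : PrimeToSixDegreeBound) (hT : TBoundAll) :
    Summit.ABC.ABC.Theses.DefiniteXi.SteinbergCore := by
  intro ε hε
  obtain ⟨C₁, hC₁⟩ := hP (ε / 2) (by linarith)
  obtain ⟨C₂, hC₂⟩ := hT (ε / 2) (by linarith)
  refine ⟨max C₁ 0 * max C₂ 0, ?_⟩
  intro a b hab h0 N _ hN Nm hodd hsq hcard hdvd
  have hNpos : (0 : ℝ) < (N : ℝ) := by exact_mod_cast Nat.pos_of_ne_zero (NeZero.ne N)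
  have hsplit : (N : ℝ) ^ (2 + ε / 2) * (N : ℝ) ^ (ε / 2) = (N : ℝ) ^ (2 + ε) := by
    rw [← Real.rpow_add hNpos]; ring_nf
  set ξ : ℕ := brandtXi (N / Nm) Nm (fun n => (freyCurve a b).LFunction n) with hξ
  set T : ℕ := ∏ q ∈ N.primeFactors, ((freyCurve a b).minimalDiscriminantNorm ℤ).factorization q
    with hTdef
  have hTle : (T : ℝ) ≤ max C₂ 0 * (N : ℝ) ^ (ε / 2) := by
    refine (hC₂ a b hab h0 N hN).trans ?_
    exact mul_le_mul_of_nonneg_right (le_max_left _ _) (by positivity)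
  have hRHS0 : (0 : ℝ) ≤ max C₁ 0 * max C₂ 0 * (N : ℝ) ^ (2 + ε) := by positivity
  by_cases hξ0 : ξ = 0
  · -- junk branch: no eigen-line / ξ = 0, the left side vanishes
    have : ξ / (ordProj[2] ξ * ordProj[3] ξ) = 0 := by rw [hξ0, Nat.zero_div]
    rw [this]
    simpa using hRHS0
  · obtain ⟨D, hDmin, hcmp⟩ := hC a b hab h0 N hN Nm hodd hsq hcard hdvd hξ0
    have hP' := hC₁ a b hab h0 N hN D hDmin
    have hcmpR : ((ξ / (ordProj[2] ξ * ordProj[3] ξ) : ℕ) : ℝ)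
        ≤ ((D.deg / (ordProj[2] D.deg * ordProj[3] D.deg) : ℕ) : ℝ) := by exact_mod_cast hcmp
    have hP'' : ((D.deg / (ordProj[2] D.deg * ordProj[3] D.deg) : ℕ) : ℝ)
        ≤ max C₁ 0 * (N : ℝ) ^ (2 + ε / 2) :=
      hP'.trans (mul_le_mul_of_nonneg_right (le_max_left _ _) (by positivity))
    have hT0 : (0 : ℝ) ≤ (T : ℝ) := by positivity
    calc ((ξ / (ordProj[2] ξ * ordProj[3] ξ) : ℕ) : ℝ) * (T : ℝ)
        ≤ (max C₁ 0 * (N : ℝ) ^ (2 + ε / 2)) * (max C₂ 0 * (N : ℝ) ^ (ε / 2)) := by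
          apply mul_le_mul (hcmpR.trans hP'') hTle hT0
          positivity
      _ = max C₁ 0 * max C₂ 0 * (N : ℝ) ^ (2 + ε) := by rw [← hsplit]; ring

/-- Sanity: the route target `FreyDegreeBound` (for minimal data) implies P6 trivially
(`cps n ≤ n`), so the split loses nothing relative to the thesis `X`. -/
theorem primeToSix_of_minimalDegreeBound
    (h : ∀ ε : ℝ, 0 < ε → ∃ C : ℝ, ∀ a b : ℤ, IsCoprime a b → a * b * (a + b) ≠ 0 →
      ∀ (N : ℕ) [NeZero N], (freyCurve a b).conductorNorm ℤ = N →
      ∀ D : ModularParametrizationData (freyCurve a b) N,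
        (∀ D' : ModularParametrizationData (freyCurve a b) N, D.deg ≤ D'.deg) →
        (D.deg : ℝ) ≤ C * (N : ℝ) ^ (2 + ε)) :
    PrimeToSixDegreeBound := by
  intro ε hε
  obtain ⟨C, hC⟩ := h ε hε
  refine ⟨C, ?_⟩
  intro a b hab h0 N _ hN D hDmin
  refine le_trans ?_ (hC a b hab h0 N hN D hDmin)
  exact_mod_cast Nat.div_le_self _ _

/-! ### The prime-to-6 part and divisibility (elementary; used by the prime-type comparison) -/

/-- `cps n = n / (2^{v₂ n} 3^{v₃ n})` is the iterated prime-power complement `ordCompl[3] (ordCompl[2] n)`. -/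
theorem cps_eq (n : ℕ) : n / (ordProj[2] n * ordProj[3] n) = ordCompl[3] (ordCompl[2] n) := by
  have h3 : (ordCompl[2] n).factorization 3 = n.factorization 3 := by
    rw [Nat.factorization_ordCompl]; simp
  rw [← Nat.div_div_eq_div_mul]
  show n / ordProj[2] n / 3 ^ n.factorization 3 = ordCompl[2] n / 3 ^ (ordCompl[2] n).factorization 3
  rw [h3]

/-- Divisibility passes to prime-to-6 parts. -/
theorem cps_dvd_of_dvd {x y : ℕ} (h : x ∣ y) :
    x / (ordProj[2] x * ordProj[3] x) ∣ y / (ordProj[2] y * ordProj[3] y) := by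
  rw [cps_eq, cps_eq]
  exact Nat.ordCompl_dvd_ordCompl_of_dvd (Nat.ordCompl_dvd_ordCompl_of_dvd h 2) 3

theorem cps_pos {y : ℕ} (hy : y ≠ 0) : 0 < y / (ordProj[2] y * ordProj[3] y) := by
  rw [cps_eq]
  exact Nat.ordCompl_pos 3 (Nat.ordCompl_pos 2 hy).ne'

theorem cps_le_of_dvd {x y : ℕ} (h : x ∣ y) (hy : y ≠ 0) :
    x / (ordProj[2] x * ordProj[3] x) ≤ y / (ordProj[2] y * ordProj[3] y) :=
  Nat.le_of_dvd (cps_pos hy) (cps_dvd_of_dvd h)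

/-! ### The comparison at PRIME type is already a corollary of the tree's Takahashi fact

From `takahashi2001_thm_2_3` (`δ · i = ξ_S · j`, `i · j = c_r`, `0 < i`): `ξ_S ∣ δ_opt · c_r`, hence
`cps ξ_S ∣ cps (δ_opt · c_r)` — the prime-`Nm` instance of `CompWeak` up to ONE extra factor `cps c_r ≤ c_r`,
which the glue below also tolerates (it lands in the T-factor).  Hypotheses are the fact's: squarefree
conductor `M r` (Frey curves with `16 ∣` the even member; the `4 ∣ N` classes need the `_of_coprime`
variant), optimal datum `P`. No Eisenstein / surjectivity / `p ∤ N` hypothesis: valid at EVERY prime `ℓ ≥ 5`. -/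
theorem xi_dvd_modularDegree_mul_ord (h : takahashi2001_thm_2_3) (W : WeierstrassCurve ℚ) [W.IsElliptic]
    (M r : ℕ) [NeZero (M * r)] (hr : r.Prime) (hsq : Squarefree (M * r))
    (hN : W.conductorNorm ℤ = M * r) (P : ModularParametrizationData W (M * r))
    (hmin : ∀ (W' : WeierstrassCurve ℚ) [W'.IsElliptic] (P' : ModularParametrizationData W' (M * r)),
      P'.f = P.f → P.modularDegree ≤ P'.modularDegree)
    (S : Brandt.XiSetup M r) :
    S.xi (fun n => W.LFunction n) ∣ P.modularDegree * (W.minimalDiscriminantNorm ℤ).factorization r := by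
  obtain ⟨i, j, _hi, hij, -, hδ⟩ := h W M r hr hsq hN P hmin S
  have h1 : S.xi (fun n => W.LFunction n) ∣ P.modularDegree * i := ⟨j, hδ⟩
  exact h1.trans (mul_dvd_mul_left _ (Dvd.intro j hij))

/-- **Prime-type comparison away from 6** (corollary of the fact):
`cps ξ_S ≤ cps (δ_opt · ord_r Δ_min)`. -/
theorem cps_xi_le_of_takahashi (h : takahashi2001_thm_2_3) (W : WeierstrassCurve ℚ) [W.IsElliptic]
    (M r : ℕ) [NeZero (M * r)] (hr : r.Prime) (hsq : Squarefree (M * r))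
    (hN : W.conductorNorm ℤ = M * r) (P : ModularParametrizationData W (M * r))
    (hmin : ∀ (W' : WeierstrassCurve ℚ) [W'.IsElliptic] (P' : ModularParametrizationData W' (M * r)),
      P'.f = P.f → P.modularDegree ≤ P'.modularDegree)
    (S : Brandt.XiSetup M r) (hc : (W.minimalDiscriminantNorm ℤ).factorization r ≠ 0) :
    S.xi (fun n => W.LFunction n) /
        (ordProj[2] (S.xi (fun n => W.LFunction n)) * ordProj[3] (S.xi (fun n => W.LFunction n)))
      ≤ (P.modularDegree * (W.minimalDiscriminantNorm ℤ).factorization r) /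
        (ordProj[2] (P.modularDegree * (W.minimalDiscriminantNorm ℤ).factorization r) *
          ordProj[3] (P.modularDegree * (W.minimalDiscriminantNorm ℤ).factorization r)) :=
  cps_le_of_dvd (xi_dvd_modularDegree_mul_ord h W M r hr hsq hN P hmin S)
    (Nat.mul_ne_zero P.deg_pos.ne' hc)

end

end Summit.ABC.ABC.Cruxes.SteinbergCore.PrimeToSixAvatar
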